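import Summits.AtomisticToContinuum.FouriersLaw.Theorems.BondHeatUncertaintyExtensiveSnapshotIrreversibilityEnergyWindowKernelDensityGradient
import Summits.AtomisticToContinuum.FouriersLaw.Theorems.OddSectorIrreversibilityResponseDensitySmoothForecast
import Literature.MathematicalPhysics.KineticTheory.LangevinChainDynkin
/-!
# Crux `ExtensiveSnapshotIrreversibility` (stmt-AtomisticToContinuum-9121): the density leaves over the tree's smooth kernel

Cell decomp-a2c, lens «grading / quantitative ladder», generation 75, part O (critic rows 1045 (iii)
/ 1049: «typed against the inventory», deliverable (1) «kernel-identification port first»).  The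
port asked for in row 1049 (1) is ALREADY IN THE TREE:
`SubdiffusiveBondHeat.pinnedChain_langevinKernel_eq_transitionKernel` and
`SubdiffusiveBondHeat.pinnedChain_isConfining` (file `…SubdiffusiveBondHeatKernelGibbsA`), and with
them CEHR Prop. 3.2 for the pinned chain, `pinnedChain_exists_transitionDensity` (file
`OddSectorIrreversibilityResponseDensitySmoothForecast`): for `ω₂, γ, T_L > 0`, `lam, β, T_R ≥ 0`,
`N ≥ 1` the chain pipeline's kernels have a JOINTLY SMOOTH nonnegative Lebesgue density,
`P_t(x, dy) = p(t, x, y) dy`, `p ∈ C^∞((0,∞) × Ω × Ω)` (Hörmander's theorem is proved in the tree).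

This file uses these theorems to strip every QUALITATIVE conjunct from the density leaves of
part N.  What is left are the two quantitative estimates, stated over any jointly smooth density
of the kernels (`IsTransitionDensity`; such a density exists by the theorem above and is unique):

* (G1ᶜ) `DepartureGradientCore` — for the equal-temperature density and both bath sites, a local
  (in the departure point) dominating function `F ≥ |∂_{x_{p_b}} p(r, ·, y)|` with
  `∫ e^{θH} F ≤ C r^{-a} e^{θ₁H(w)}`, `0 < r ≤ 1`, `∃ a < 1`;  ⟹ (G1ᵈ) PROVED here
  (`departureDensityGradientBound_of_core`: measurability, the kernel identity, the weighted
  integrability of `p` (CEHR (3.4), `lintegral_exp_mul_hamiltonian_pinnedChainSemigroup_le`) and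
  the `HasDerivAt` package all come from the tree).
* (G1*ᶜ) `ArrivalGradientCore` — for the two-temperature densities, `|δ| < δ₀`:
  `∫ e^{θ₁H(y)} |∂_{y_{p_b}} p(s, z, y)| dy ≤ C s^{-b₀} e^{θ₂H(z)}`, `0 < s ≤ 1`, `∃ b₀ < 1`;
  ⟹ (G1*ᵈ) PROVED here (`arrivalDensityGradientBound_of_core`; the proof shrinks `δ₀` so that
  both temperatures stay positive and `θ₁ < 1/max(T ± δ/2)`).
* ★ `kernelTemperatureLipschitz_of_densityCores : (D) → (G1ᶜ) → (G1*ᶜ) → S3` and the junction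
  `K_fix ⟸ A0 ∧ A2 ∧ (D) ∧ (G1ᶜ) ∧ (G1*ᶜ) ∧ A3p ∧ A4` (`snapshotKLUpperExpansion_of_atoms₇O`).

So beneath S3 the record now reads: two WEIGHTED SMALL-TIME GRADIENT BOUNDS for the (proved,
smooth) hypoelliptic heat kernel of the pinned chain in the directly-noised bath directions —
departure side (G1ᶜ) and arrival side (G1*ᶜ) — plus the Duhamel identity (D).  Both cores are
WEAKER than the summit (finite time, fixed `N`, no steady state) and carry exponents as RANGES.
Harmonic calibration (lam = β = 0, numerics/EXPONENT-CALIBRATION.out, SCHUR-RATIO.out): both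
weighted `L¹` norms scale like `t^{-1/2}` (`s·(Q_s⁻¹)_{bb} → 3N − 4`).

References: N. Cuneo, J.-P. Eckmann, M. Hairer, L. Rey-Bellet, EJP 23 (2018) no. 55, Prop. 3.2,
eq. (3.4); L. Rey-Bellet, L. E. Thomas, Comm. Math. Phys. 225 (2002) 305–329, Thm 2.1;
L. Hörmander, Acta Math. 119 (1967) 147–171, Thm 1.1; S. Kusuoka, D. Stroock, J. Fac. Sci. Univ.
Tokyo 34 (1987) 391–442, §3 (the unweighted local form of such kernel-gradient bounds).
-/

noncomputable section

namespace Summit.AtomisticToContinuum.FouriersLaw.Theorems.ExtensiveSnapshotIrreversibility.EnergyWindow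

open MeasureTheory ProbabilityTheory Filter Topology Real
open scoped ENNReal NNReal ContDiff
open Literature.MathematicalPhysics.KineticTheory.HeatConduction
open Literature.Probability.Process

/-! ## 1. Smooth transition densities of the pinned chain (from the tree) -/

/-- `IsTransitionDensity ω₂ lam β γ N T_L T_R p`: `p(t, x, y)` is a jointly smooth (on `t > 0`),
nonnegative Lebesgue density of the transition kernels of `pinnedChain ω₂ lam β γ` with `N` sites
and bath temperatures `T_L`, `T_R`: `P_t(x, dy) = p(t, x, y) dy` for every `t > 0`.  This is
literally the conclusion of the tree's `pinnedChain_exists_transitionDensity` (CEHR Prop. 3.2).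
[cite: CuneoEckmannHairerReyBellet2018, Prop 3.2] -/
def IsTransitionDensity (ω₂ lam β γ : ℝ) (N : ℕ) (T_L T_R : ℝ)
    (p : ℝ → PhaseSpace N → PhaseSpace N → ℝ) : Prop :=
  ContDiffOn ℝ ∞ (fun w : ℝ × PhaseSpace N × PhaseSpace N => p w.1 w.2.1 w.2.2)
      (Set.Ioi (0 : ℝ) ×ˢ Set.univ) ∧
    (∀ t : ℝ, 0 < t → ∀ x y, 0 ≤ p t x y) ∧
    ∀ t : ℝ≥0, 0 < t → ∀ x : PhaseSpace N,
      (pinnedChain ω₂ lam β γ).transitionKernel N T_L T_R t x =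
        volume.withDensity fun y => ENNReal.ofReal (p t x y)

/-- **Existence** (CEHR Prop. 3.2 for the pinned chain, proved in the tree from Hörmander's
theorem): for `ω₂, γ, T_L > 0`, `lam, β, T_R ≥ 0`, `N ≥ 1` a jointly smooth transition density
exists. [cite: CuneoEckmannHairerReyBellet2018, Prop 3.2] -/
theorem isTransitionDensity_exists {ω₂ lam β γ : ℝ} (hω : 0 < ω₂) (hl : 0 ≤ lam) (hβ : 0 ≤ β)
    (hγ : 0 < γ) {N : ℕ} (hN : 0 < N) {T_L T_R : ℝ} (hL : 0 < T_L) (hR : 0 ≤ T_R) :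
    ∃ p, IsTransitionDensity ω₂ lam β γ N T_L T_R p :=
  pinnedChain_exists_transitionDensity hω hl hβ hγ hN hL hR

namespace IsTransitionDensity

variable {ω₂ lam β γ : ℝ} {N : ℕ} {T_L T_R : ℝ} {p : ℝ → PhaseSpace N → PhaseSpace N → ℝ}

/-- The density is jointly `C¹` in (departure, arrival) at each fixed time `t > 0`. [folklore] -/
theorem contDiff_uncurry (hp : IsTransitionDensity ω₂ lam β γ N T_L T_R p) {t : ℝ} (ht : 0 < t) :
    ContDiff ℝ 1 fun v : PhaseSpace N × PhaseSpace N => p t v.1 v.2 := by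
  have h : ContDiff ℝ ∞ fun v : PhaseSpace N × PhaseSpace N => p t v.1 v.2 :=
    hp.1.comp_contDiff
      (f := fun v : PhaseSpace N × PhaseSpace N => ((t, v) : ℝ × PhaseSpace N × PhaseSpace N))
      (contDiff_prodMk_right t) fun v => ⟨ht, Set.mem_univ _⟩
  exact h.of_le (by exact_mod_cast le_top)

/-- The density is `C¹` in the departure point. [folklore] -/
theorem contDiff_left (hp : IsTransitionDensity ω₂ lam β γ N T_L T_R p) {t : ℝ} (ht : 0 < t)
    (y : PhaseSpace N) : ContDiff ℝ 1 fun x => p t x y :=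
  (hp.contDiff_uncurry ht).comp (contDiff_prodMk_left y)

/-- The density is `C¹` in the arrival point. [folklore] -/
theorem contDiff_right (hp : IsTransitionDensity ω₂ lam β γ N T_L T_R p) {t : ℝ} (ht : 0 < t)
    (x : PhaseSpace N) : ContDiff ℝ 1 (p t x) :=
  (hp.contDiff_uncurry ht).comp (contDiff_prodMk_right x)

/-- The kernel identity at real time `t > 0`: `P_t(x, ·) = p(t, x, ·) dy`. [folklore] -/
theorem kernel_eq (hp : IsTransitionDensity ω₂ lam β γ N T_L T_R p) {t : ℝ} (ht : 0 < t)
    (x : PhaseSpace N) :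
    (pinnedChain ω₂ lam β γ).transitionKernel N T_L T_R t.toNNReal x =
      volume.withDensity fun y => ENNReal.ofReal (p t x y) := by
  have h := hp.2.2 _ (Real.toNNReal_pos.2 ht) x
  rwa [Real.coe_toNNReal _ ht.le] at h

/-- The departure-momentum partial derivative `y ↦ ∂_{x_{p_b}} p(t, ·, y)(x₀)` is continuous, hence
measurable, in the arrival point. [folklore] -/
theorem measurable_partialP_left (hp : IsTransitionDensity ω₂ lam β γ N T_L T_R p) {t : ℝ}
    (ht : 0 < t) (b : Fin N) (x₀ : PhaseSpace N) :
    Measurable fun y => partialP b (fun x => p t x y) x₀ := by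
  have hv : ∀ y, partialP b (fun x => p t x y) x₀ =
      fderiv ℝ (fun x => p t x y) x₀ ((0, Pi.single b 1) : PhaseSpace N) := fun y =>
    congrFun (partialP_eq_fderiv ((hp.contDiff_left ht y).differentiable one_ne_zero) b) x₀
  simp_rw [hv]
  have hu : ContDiff ℝ 1 (Function.uncurry fun (y : PhaseSpace N) (x : PhaseSpace N) => p t x y) :=
    (hp.contDiff_uncurry ht).comp (contDiff_snd.prodMk contDiff_fst)
  exact (hu.fderiv_apply (n := 0) contDiff_const contDiff_const (by norm_num)).continuous.measurable

end IsTransitionDensity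

/-- For differentiable `g`, `τ ↦ g(w[p_b := τ])` has derivative `∂_{p_b} g (w[p_b := t])` at `t`.
[folklore] -/
theorem hasDerivAt_update_partialP {N : ℕ} {g : PhaseSpace N → ℝ} (hg : Differentiable ℝ g)
    (b : Fin N) (w : PhaseSpace N) (t : ℝ) :
    HasDerivAt (fun τ => g (w.1, Function.update w.2 b τ))
      (partialP b g (w.1, Function.update w.2 b t)) t := by
  have hd : DifferentiableAt ℝ (fun τ : ℝ => g (w.1, Function.update w.2 b τ)) t := by
    have hpath : HasDerivAt (fun τ : ℝ => ((w.1, Function.update w.2 b τ) : PhaseSpace N))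
        ((0 : Fin N → ℝ), Pi.single b (1 : ℝ)) t :=
      (hasDerivAt_const t w.1).prodMk (hasDerivAt_update w.2 b t)
    exact ((hg _).hasFDerivAt.comp_hasDerivAt t hpath).differentiableAt
  have h : partialP b g (w.1, Function.update w.2 b t) =
      deriv (fun τ => g (w.1, Function.update w.2 b τ)) t := by
    simp only [partialP, Function.update_idem, Function.update_self]
  rw [h]
  exact hd.hasDerivAt

/-- **Weighted integrability of a transition density** (from CEHR (3.4) for the chain pipeline's
kernels, `lintegral_exp_mul_hamiltonian_pinnedChainSemigroup_le`): for `T_L, T_R > 0` and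
`0 < θ < 1/max(T_L, T_R)`, `y ↦ e^{θH(y)} p(t, x, y)` is Lebesgue integrable.
[cite: CuneoEckmannHairerReyBellet2018, eq. (3.4)] -/
theorem integrable_exp_mul_hamiltonian_mul_density {ω₂ lam β γ : ℝ} (hω : 0 < ω₂) (hl : 0 ≤ lam)
    (hβ : 0 ≤ β) (hγ : 0 ≤ γ) {N : ℕ} (hN : 0 < N) {T_L T_R : ℝ} (hL : 0 < T_L) (hR : 0 < T_R)
    {θ : ℝ} (hθ : 0 < θ) (hθ' : θ < 1 / max T_L T_R)
    {p : ℝ → PhaseSpace N → PhaseSpace N → ℝ} (hp : IsTransitionDensity ω₂ lam β γ N T_L T_R p)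
    {t : ℝ} (ht : 0 < t) (x : PhaseSpace N) :
    Integrable fun y => Real.exp (θ * (pinnedChain ω₂ lam β γ).hamiltonian N y) * p t x y := by
  have hcont : Continuous (p t x) := (hp.contDiff_right ht x).continuous
  have hE : Continuous fun y => Real.exp (θ * (pinnedChain ω₂ lam β γ).hamiltonian N y) :=
    Real.continuous_exp.comp
      (continuous_const.mul (pinnedChain_continuous_hamiltonian ω₂ lam β γ N))
  refine ⟨(hE.mul hcont).aestronglyMeasurable, ?_⟩
  rw [hasFiniteIntegral_iff_ofReal (Eventually.of_forall fun y =>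
    mul_nonneg (Real.exp_pos _).le (hp.2.1 t ht x y))]
  have h34 := lintegral_exp_mul_hamiltonian_pinnedChainSemigroup_le hω hl hβ hγ hN hL.le hR.le hL hR
    hθ hθ' t.toNNReal x
  rw [hp.kernel_eq ht x, lintegral_withDensity_eq_lintegral_mul _ hcont.measurable.ennreal_ofReal
    hE.measurable.ennreal_ofReal] at h34
  calc ∫⁻ y, ENNReal.ofReal (Real.exp (θ * (pinnedChain ω₂ lam β γ).hamiltonian N y) * p t x y)
      = ∫⁻ y, ((fun y => ENNReal.ofReal (p t x y)) *
          fun y => ENNReal.ofReal (Real.exp (θ * (pinnedChain ω₂ lam β γ).hamiltonian N y))) y := by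
        refine lintegral_congr fun y => ?_
        rw [Pi.mul_apply, ENNReal.ofReal_mul (Real.exp_pos _).le, mul_comm]
    _ < ⊤ := lt_of_le_of_lt h34 ENNReal.ofReal_lt_top

/-! ## 2. The two quantitative cores -/

/-- **(G1ᶜ) `DepartureGradientCore`** (OPEN · ATTACKABLE-L; WEAKER than the summit): for positive
parameters, `T > 0`, `N ≥ 2`, rates `0 < θ < θ₁ < 1/T`, there are `a < 1` and `C` such that for
every jointly smooth density `p` of the EQUAL-temperature kernels, every `0 < r ≤ 1`, both bath
sites `b` and every departure point `w` there is a dominating function `F` of the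
departure-momentum derivative `∂_{x_{p_b}} p(r, ·, y)` on a neighbourhood
`{w[p_b := t] : |t − w_{p_b}| < ε}` with `∫ e^{θH} F ≤ C r^{-a} e^{θ₁H(w)}` — a
Lyapunov-weighted small-time `W^{1,1}` bound of the hypoelliptic kernel in the directly-noised
departure direction (Kolmogorov scaling predicts `a = ½`; harmonic calibration `g1 ∼ r^{-1/2}`).
(after CuneoEckmannHairerReyBellet2018, Prop 3.2) [route leaf · named hypothesis of this cell, NOT filed as a literature fact] -/
def DepartureGradientCore : Prop :=
  ∀ ω₂ lam β γ : ℝ, 0 < ω₂ → 0 < lam → 0 < β → 0 < γ →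
    ∀ T : ℝ, 0 < T → ∀ (N : ℕ) (hN : 2 ≤ N), ∀ θ θ₁ : ℝ, 0 < θ → θ < θ₁ → θ₁ < 1 / T →
      ∃ a C : ℝ, a < 1 ∧ ∀ p : ℝ → PhaseSpace N → PhaseSpace N → ℝ,
        IsTransitionDensity ω₂ lam β γ N T T p → ∀ r : ℝ, 0 < r → r ≤ 1 →
          ∀ b : Fin N, (b = leftBath N hN ∨ b = rightBath N hN) → ∀ w : PhaseSpace N,
            ∃ ε : ℝ, 0 < ε ∧ ∃ F : PhaseSpace N → ℝ,
              (∀ t : ℝ, |t - w.2 b| < ε → ∀ y,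
                  |partialP b (fun x => p r x y) (w.1, Function.update w.2 b t)| ≤ F y) ∧
              Integrable (fun y =>
                Real.exp (θ * (pinnedChain ω₂ lam β γ).hamiltonian N y) * F y) ∧
              ∫ y, Real.exp (θ * (pinnedChain ω₂ lam β γ).hamiltonian N y) * F y ≤
                C * r ^ (-a) * Real.exp (θ₁ * (pinnedChain ω₂ lam β γ).hamiltonian N w)

/-- **(G1*ᶜ) `ArrivalGradientCore`** (OPEN · ATTACKABLE-L; WEAKER than the summit): for positive
parameters, `T > 0`, `N ≥ 2`, rates `0 < θ₁ < θ₂ < 1/T`, there are `b₀ < 1`, `δ₀ > 0`, `C` such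
that for every `|δ| < δ₀`, every jointly smooth density `p` of the kernels with baths `T ± δ/2`,
every `0 < s ≤ 1`, `z` and both bath sites:
`∫ e^{θ₁H(y)} |∂_{y_{p_b}} p(s, z, y)| dy ≤ C s^{-b₀} e^{θ₂H(z)}` — the Lyapunov-weighted `L¹`
norm of the arrival-momentum logarithmic derivative (the Malliavin integration-by-parts weight),
uniform in the temperature perturbation (Kolmogorov scaling predicts `b₀ = ½`; harmonic
calibration `s·(Q_s⁻¹)_{bb} → 3N − 4`). (after CuneoEckmannHairerReyBellet2018, Prop 3.2) [route leaf · named hypothesis of this cell, NOT filed as a literature fact] -/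
def ArrivalGradientCore : Prop :=
  ∀ ω₂ lam β γ : ℝ, 0 < ω₂ → 0 < lam → 0 < β → 0 < γ →
    ∀ T : ℝ, 0 < T → ∀ (N : ℕ) (hN : 2 ≤ N), ∀ θ₁ θ₂ : ℝ, 0 < θ₁ → θ₁ < θ₂ → θ₂ < 1 / T →
      ∃ b₀ δ₀ C : ℝ, b₀ < 1 ∧ 0 < δ₀ ∧ ∀ δ : ℝ, |δ| < δ₀ →
        ∀ p : ℝ → PhaseSpace N → PhaseSpace N → ℝ,
          IsTransitionDensity ω₂ lam β γ N (T + δ / 2) (T - δ / 2) p →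
          ∀ s : ℝ, 0 < s → s ≤ 1 → ∀ z : PhaseSpace N,
            ∀ b : Fin N, (b = leftBath N hN ∨ b = rightBath N hN) →
              Integrable (fun y =>
                Real.exp (θ₁ * (pinnedChain ω₂ lam β γ).hamiltonian N y) * |partialP b (p s z) y|) ∧
              ∫ y, Real.exp (θ₁ * (pinnedChain ω₂ lam β γ).hamiltonian N y) *
                  |partialP b (p s z) y| ≤
                C * s ^ (-b₀) * Real.exp (θ₂ * (pinnedChain ω₂ lam β γ).hamiltonian N z)

/-! ## 3. (G1*ᶜ) ⟹ (G1*ᵈ) -/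

/-- ★ **(G1*ᶜ) ⟹ (G1*ᵈ)**: the arrival-side core gives `ArrivalDensityGradientBound` — the `C¹`
density, its nonnegativity, the kernel identity and the weighted integrability of `p` are supplied
by the tree (`pinnedChain_exists_transitionDensity`, CEHR (3.4)); `δ₀` is shrunk to
`min δ₀ (min T (1/θ₁ − T))` so that both temperatures are positive and `θ₁ < 1/max(T ± δ/2)`.
[cite: CuneoEckmannHairerReyBellet2018, Prop 3.2, eq. (3.4)] -/
theorem arrivalDensityGradientBound_of_core (hA : ArrivalGradientCore) :
    ArrivalDensityGradientBound := by
  intro ω₂ lam β γ hω hl hβ hγ T hT N hN θ₁ θ₂ hθ₁ hθ₁₂ hθ₂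
  obtain ⟨b₀, δ₀, C, hb₀, hδ₀, hmain⟩ := hA ω₂ lam β γ hω hl hβ hγ T hT N hN θ₁ θ₂ hθ₁ hθ₁₂ hθ₂
  have hN0 : 0 < N := by omega
  have hθ₁T : θ₁ < 1 / T := hθ₁₂.trans hθ₂
  have h1 : θ₁ * T < 1 := by rwa [lt_div_iff₀ hT] at hθ₁T
  have h2 : 0 < 1 / θ₁ - T := by
    rw [sub_pos, lt_div_iff₀ hθ₁]; linarith [mul_comm θ₁ T]
  refine ⟨b₀, min δ₀ (min T (1 / θ₁ - T)), C, hb₀, lt_min hδ₀ (lt_min hT h2),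
    fun δ hδ s hs0 hs1 z => ?_⟩
  have hδ₀' : |δ| < δ₀ := lt_of_lt_of_le hδ (min_le_left _ _)
  have hδT : |δ| < T := lt_of_lt_of_le hδ ((min_le_right _ _).trans (min_le_left _ _))
  have hδθ : |δ| < 1 / θ₁ - T := lt_of_lt_of_le hδ ((min_le_right _ _).trans (min_le_right _ _))
  have hδ1 := le_abs_self δ
  have hδ2 := neg_abs_le δ
  have hL : 0 < T + δ / 2 := by linarith
  have hR : 0 < T - δ / 2 := by linarith
  have hmaxpos : 0 < max (T + δ / 2) (T - δ / 2) := lt_max_of_lt_left hL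
  have hθmax : θ₁ < 1 / max (T + δ / 2) (T - δ / 2) := by
    rw [lt_div_iff₀ hmaxpos]
    have hm : max (T + δ / 2) (T - δ / 2) ≤ T + |δ| := max_le (by linarith) (by linarith)
    have hT' : θ₁ * (T + |δ|) < 1 := by
      have := mul_lt_mul_of_pos_left (show T + |δ| < 1 / θ₁ by linarith) hθ₁
      rwa [mul_one_div_cancel hθ₁.ne'] at this
    exact lt_of_le_of_lt (mul_le_mul_of_nonneg_left hm hθ₁.le) hT'
  obtain ⟨p, hp⟩ := isTransitionDensity_exists hω hl.le hβ.le hγ hN0 hL hR.le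
  refine ⟨p s z, hp.contDiff_right hs0 z, fun y => hp.2.1 s hs0 z y, ?_, ?_, fun b hb => ?_⟩
  · show (pinnedChain ω₂ lam β γ).transitionKernel N (T + δ / 2) (T - δ / 2) s.toNNReal z = _
    exact hp.kernel_eq hs0 z
  · exact integrable_exp_mul_hamiltonian_mul_density hω hl.le hβ.le hγ.le hN0 hL hR hθ₁ hθmax hp
      hs0 z
  · exact hmain δ hδ₀' p hp s hs0 hs1 z b hb

/-! ## 4. (G1ᶜ) ⟹ (G1ᵈ) -/

/-- ★ **(G1ᶜ) ⟹ (G1ᵈ)**: the departure-side core gives `DepartureDensityGradientBound` — the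
density, its measurability and nonnegativity, the kernel identity, the weighted integrability and
the `HasDerivAt` package along `t ↦ w[p_b := t]` (`hasDerivAt_update_partialP`, with
`p' t y = ∂_{x_{p_b}} p(r, ·, y)(w[p_b := t])`, measurable in `y` by joint smoothness) are supplied
by the tree; the core supplies the dominating function and its weighted bound.
[cite: CuneoEckmannHairerReyBellet2018, Prop 3.2, eq. (3.4)] -/
theorem departureDensityGradientBound_of_core (hG : DepartureGradientCore) :
    DepartureDensityGradientBound := by
  intro ω₂ lam β γ hω hl hβ hγ T hT N hN θ θ₁ hθ hθθ₁ hθ₁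
  obtain ⟨a, C, ha, hmain⟩ := hG ω₂ lam β γ hω hl hβ hγ T hT N hN θ θ₁ hθ hθθ₁ hθ₁
  have hN0 : 0 < N := by omega
  have hθT : θ < 1 / max T T := by rw [max_self]; exact hθθ₁.trans hθ₁
  obtain ⟨p, hp⟩ := isTransitionDensity_exists hω hl.le hβ.le hγ hN0 hT hT.le
  refine ⟨a, C, ha, fun r hr0 hr1 => ⟨p r, fun w => (hp.contDiff_right hr0 w).continuous.measurable,
    fun w y => hp.2.1 r hr0 w y, fun w => hp.kernel_eq hr0 w,
    fun w =>
      integrable_exp_mul_hamiltonian_mul_density hω hl.le hβ.le hγ.le hN0 hT hT hθ hθT hp hr0 w,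
    fun b hb w => ?_⟩⟩
  obtain ⟨ε, hε, F, hdom, hintF, hbound⟩ := hmain p hp r hr0 hr1 b hb w
  refine ⟨ε, hε, fun t y => partialP b (fun x => p r x y) (w.1, Function.update w.2 b t), F,
    fun t _ y => ?_, hdom, hp.measurable_partialP_left hr0 b _, hintF, hbound⟩
  exact hasDerivAt_update_partialP ((hp.contDiff_left hr0 y).differentiable one_ne_zero) b w t

/-! ## 5. The composite and the junction -/

/-- ★★ **S3 ⟸ (D) ∧ (G1ᶜ) ∧ (G1*ᶜ)**: the Duhamel identity and the two weighted small-time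
gradient bounds of the tree's smooth hypoelliptic kernel (departure and arrival bath momenta)
give `KernelTemperatureLipschitz`. [cite: CuneoEckmannHairerReyBellet2018, §3] -/
theorem kernelTemperatureLipschitz_of_densityCores (hD : KernelTemperatureDuhamel)
    (hG : DepartureGradientCore) (hA : ArrivalGradientCore) : KernelTemperatureLipschitz :=
  kernelTemperatureLipschitz_of_densityGradients hD (departureDensityGradientBound_of_core hG)
    (arrivalDensityGradientBound_of_core hA)

/-- **Glue `A0 → A2 → (D) → (G1ᶜ) → (G1*ᶜ) → A3p → A4 → (W)`.** [folklore] -/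
theorem energyWindowControl_of_atoms₇O (h0 : NessGibbsReweighting) (h2 : NessOddLogRatioBound)
    (hD : KernelTemperatureDuhamel) (hG : DepartureGradientCore) (hA : ArrivalGradientCore)
    (h3p : NessFloorMeanValue) (h4 : NessLinearResponseL2) : EnergyWindowControl :=
  energyWindowControl_of_atoms₅K h0 h2 (kernelTemperatureLipschitz_of_densityCores hD hG hA) h3p h4

/-- ★ **The junction `K_fix ⟸ A0 ∧ A2 ∧ (D) ∧ (G1ᶜ) ∧ (G1*ᶜ) ∧ A3p ∧ A4`.** [folklore] -/
theorem snapshotKLUpperExpansion_of_atoms₇O (h0 : NessGibbsReweighting)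
    (h2 : NessOddLogRatioBound) (hD : KernelTemperatureDuhamel)
    (hG : DepartureGradientCore) (hA : ArrivalGradientCore)
    (h3p : NessFloorMeanValue) (h4 : NessLinearResponseL2) : SnapshotKLUpperExpansion :=
  snapshotKLUpperExpansion_of_atoms₅K h0 h2 (kernelTemperatureLipschitz_of_densityCores hD hG hA)
    h3p h4

end Summit.AtomisticToContinuum.FouriersLaw.Theorems.ExtensiveSnapshotIrreversibility.EnergyWindow
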